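import Summits.BirchSwinnertonDyer.BirchSwinnertonDyer.Theorems.SignedLowerHalvesSmallImageLowerHalfBothSignsRttD2TwistSemilinear
import Summits.BirchSwinnertonDyer.BirchSwinnertonDyer.Theorems.SignedLowerHalvesSmallImageLowerHalfBothSignsRttD2TwistRing
import Summits.BirchSwinnertonDyer.BirchSwinnertonDyer.Theorems.SignedLowerHalvesSmallImageLowerHalfBothSignsRttD2TwistPackage
import Summits.BirchSwinnertonDyer.BirchSwinnertonDyer.Theorems.SignedLowerHalvesSmallImageLowerHalfBothSignsRttD2TwistUnits
import HarnessLib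

/-!
# Route `SignedLowerHalves`, crux L `SmallImageLowerHalfBothSigns` (stmt-BirchSwinnertonDyer-23599), line `rtt_w3` v14 → v15 — E2, row «D-tw-alg» part C (LEAD):
# THE TWISTED ZETA SKELETON `Tw_* D₀` — the consumers' `σ D e₀ e₁ he₁ haZ e₂ he₂` from honda's `twistEquiv` + `twistEquiv_smul` and LEAD's `exists_twistRingEquiv`

WHY (RULING «U»; BRIEF-E2 rev 5.2 §3 row D-tw-coh; consumers p784139 `charRoad_E2_of_roadD_junction_depleted_of_twist` / p784278). Given models `Dᵢ` (`i = 0,1,2`) of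
`𝐇^i(𝒪_K[1/p𝔣], Λ_𝒪(θ)(1))` and `Dᵢ'` of the same for `θ'` (same tower `κ₁ κ₂`, same generators `γ₁ γ₂`), honda g23's twist hypotheses (thresholds `m`, `hN`, `hm`),
a zeta skeleton `Dsk` on the `θ`-carriers (e.g. `TwistedIwasawaDataO.toZetaSkeleton`), and `u_i = θ(γ_i)θ'(γ_i)⁻¹ ∈ 1 + 𝔪`: ★★★ `exists_twistSkeleton` — there are
`σ : Λ_{𝒪,2} ≃+* Λ_{𝒪,2}` (p789673), a zeta skeleton `Dsk'` on the `θ'`-carriers (`J := σ(J)`, `nsub := σ ∘ nsub`, `aZeta := Tw ∘ aZeta`), and `σ`-semilinear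
additive equivalences `eᵢ := twistEquiv` with `e₁ (Dsk.aZeta a) = Dsk'.aZeta a` — literally the binders `σ D e₀ e₁ he₁ haZ e₂ he₂` of the consumers, so that
`Thm52Shape`/finiteness for `θ' = θ*` follow from the cited `θ = χ₀` case by p782462 `thm52Shape_of_semilinearEquiv`.

THEOREMS ONLY (`--supports stmt-BirchSwinnertonDyer-23599` helper); closes nothing; crux L, crux M, E2 and BSD remain OPEN and are proved for NO curve by any of this.
[cite: JohnsonLeungKings2011, §4.1–§4.2, §5.1–§5.2] [cite: Rubin2000, Ch. VI §6.1–6.2] [cite: Washington1997, §13.2]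
-/

set_option autoImplicit false
-- the Theorems namespace of this sub repeats the summit name by design (D-0017 nested layout)
set_option linter.dupNamespace false

noncomputable section

open scoped NumberField
open CategoryTheory Field IsDedekindDomain PowerSeries
open Literature.NumberTheory.GaloisRepresentations
open Literature.NumberTheory.EllipticCurves
open Literature.NumberTheory.ComplexMultiplication.EllipticUnits
open Literature.NumberTheory.ComplexMultiplication.EllipticUnits.JohnsonLeungKings2011

namespace Summit.BirchSwinnertonDyer.BirchSwinnertonDyer.Theorems.SmallImageRttD2Twist

universe w

section Skeleton

variable {K : Type} [Field K] [NumberField K] {p : ℕ} [Fact p.Prime] (S : Set (PadicAlgCl p)) [FiniteDimensional ℚ_[p] (padicCoeffField S)]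
  (κ₁ κ₂ : ZpExtension K p) {γ₁ γ₂ : absoluteGaloisGroup K} (θ θ' : absoluteGaloisGroup K →ₜ* (padicCoeffIntegers S)ˣ)
  (𝔣 : Ideal (𝓞 K)) (m : ℕ → ℕ) (hmono : Monotone m)
  (hN : ∀ k, ∀ σ ∈ ramificationSubgroup K (suppPF p 𝔣), ∃ b : padicCoeffIntegers S,
    ((θ' σ : (padicCoeffIntegers S)ˣ) : padicCoeffIntegers S) = (θ σ : (padicCoeffIntegers S)ˣ) + ((p : padicCoeffIntegers S)) ^ k * b)
  (hm : ∀ k, ∀ σ ∈ JohnsonLeungKings2011.pairLayerSubgroup κ₁ κ₂ (m k), ∃ b : padicCoeffIntegers S,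
    ((θ' σ : (padicCoeffIntegers S)ˣ) : padicCoeffIntegers S) = (θ σ : (padicCoeffIntegers S)ˣ) + ((p : padicCoeffIntegers S)) ^ k * b)
  (D₀ : IwasawaCohomologyDataO S κ₁ κ₂ γ₁ γ₂ θ 𝔣 0) (D₁ : IwasawaCohomologyDataO S κ₁ κ₂ γ₁ γ₂ θ 𝔣 1) (D₂ : IwasawaCohomologyDataO S κ₁ κ₂ γ₁ γ₂ θ 𝔣 2)
  (D₀' : IwasawaCohomologyDataO S κ₁ κ₂ γ₁ γ₂ θ' 𝔣 0) (D₁' : IwasawaCohomologyDataO S κ₁ κ₂ γ₁ γ₂ θ' 𝔣 1) (D₂' : IwasawaCohomologyDataO S κ₁ κ₂ γ₁ γ₂ θ' 𝔣 2)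
  {Aidx : Type w} (Dsk : ZetaSkeleton (IwasawaAlgebraO₂ S) Aidx D₀.H D₁.H D₂.H)
  (h₁ : ‖((((θ γ₁ * (θ' γ₁)⁻¹ : (padicCoeffIntegers S)ˣ)) : padicCoeffIntegers S) : PadicAlgCl p) - 1‖ < 1)
  (h₂ : ‖((((θ γ₂ * (θ' γ₂)⁻¹ : (padicCoeffIntegers S)ˣ)) : padicCoeffIntegers S) : PadicAlgCl p) - 1‖ < 1)

include hmono hN hm h₁ h₂ in
/-- ★★★ **The twisted zeta skeleton.** See the module docstring: `σ`, `Dsk' = Tw_* Dsk`, `eᵢ = twistEquiv`, with `he₁ haZ he₂` and the transported `nsub`/`J`.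
[cite: JohnsonLeungKings2011, §4.1–§4.2, §5.1–§5.2] [cite: Rubin2000, Ch. VI §6.1–6.2] -/
theorem exists_twistSkeleton :
    ∃ (σ : IwasawaAlgebraO₂ S ≃+* IwasawaAlgebraO₂ S) (Dsk' : ZetaSkeleton (IwasawaAlgebraO₂ S) Aidx D₀'.H D₁'.H D₂'.H)
      (e₀ : D₀.H ≃+ D₀'.H) (e₁ : D₁.H ≃+ D₁'.H) (e₂ : D₂.H ≃+ D₂'.H),
      (∀ (r : IwasawaAlgebraO₂ S) (x : D₁.H), e₁ (r • x) = σ r • e₁ x) ∧ (∀ a : Aidx, e₁ (Dsk.aZeta a) = Dsk'.aZeta a) ∧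
      (∀ (r : IwasawaAlgebraO₂ S) (x : D₂.H), e₂ (r • x) = σ r • e₂ x) ∧ (∀ (r : IwasawaAlgebraO₂ S) (x : D₀.H), e₀ (r • x) = σ r • e₀ x) ∧
      (∀ a : Aidx, Dsk'.nsub a = σ (Dsk.nsub a)) ∧ Dsk'.J = Dsk.J.map σ ∧
      σ X = C (C (((θ γ₁ * (θ' γ₁)⁻¹ : (padicCoeffIntegers S)ˣ)) : padicCoeffIntegers S)) * (1 + X) - 1 ∧
      σ (C X) = C (C (((θ γ₂ * (θ' γ₂)⁻¹ : (padicCoeffIntegers S)ˣ)) : padicCoeffIntegers S)) * (1 + C X) - 1 ∧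
      (∀ c : padicCoeffIntegers S, σ (C (C c)) = C (C c)) := by
  obtain ⟨σ, hσX, hσCX', hσC, -, -⟩ := exists_twistRingEquiv S (θ γ₁ * (θ' γ₁)⁻¹) (θ γ₂ * (θ' γ₂)⁻¹) h₁ h₂
  have hσCX : σ.toRingHom (C X) = C (C (((θ γ₂ * (θ' γ₂)⁻¹ : (padicCoeffIntegers S)ˣ)) : padicCoeffIntegers S)) * (1 + C X) - 1 := by
    rw [RingEquiv.toRingHom_eq_coe, RingHom.coe_coe, hσCX', map_sub, map_one, map_mul, map_add, map_one]
  -- the three twists and their semilinearity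
  let e₀ : D₀.H ≃+ D₀'.H := twistEquiv S κ₁ κ₂ θ θ' 𝔣 m hmono hN hm D₀ D₀'
  let e₁ : D₁.H ≃+ D₁'.H := twistEquiv S κ₁ κ₂ θ θ' 𝔣 m hmono hN hm D₁ D₁'
  let e₂ : D₂.H ≃+ D₂'.H := twistEquiv S κ₁ κ₂ θ θ' 𝔣 m hmono hN hm D₂ D₂'
  have he₀ : ∀ (r : IwasawaAlgebraO₂ S) (x : D₀.H), e₀ (r • x) = σ r • e₀ x := fun r x ↦
    twistEquiv_smul S κ₁ κ₂ θ θ' 𝔣 (Nat.zero_le 2) m hmono hN hm D₀ D₀' σ.toRingHom hσC hσX hσCX r x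
  have he₁ : ∀ (r : IwasawaAlgebraO₂ S) (x : D₁.H), e₁ (r • x) = σ r • e₁ x := fun r x ↦
    twistEquiv_smul S κ₁ κ₂ θ θ' 𝔣 (by norm_num) m hmono hN hm D₁ D₁' σ.toRingHom hσC hσX hσCX r x
  have he₂ : ∀ (r : IwasawaAlgebraO₂ S) (x : D₂.H), e₂ (r • x) = σ r • e₂ x := fun r x ↦
    twistEquiv_smul S κ₁ κ₂ θ θ' 𝔣 le_rfl m hmono hN hm D₂ D₂' σ.toRingHom hσC hσX hσCX r x
  -- the transported skeleton
  have hreg : ∀ a : Aidx, IsSMulRegular (IwasawaAlgebraO₂ S) (σ (Dsk.nsub a)) := fun a x y hxy ↦ by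
    apply σ.symm.injective
    apply Dsk.nsub_regular a
    change Dsk.nsub a * σ.symm x = Dsk.nsub a * σ.symm y
    apply σ.injective
    rw [map_mul, map_mul, RingEquiv.apply_symm_apply, RingEquiv.apply_symm_apply]
    exact hxy
  let Dsk' : ZetaSkeleton (IwasawaAlgebraO₂ S) Aidx D₀'.H D₁'.H D₂'.H :=
    { J := Dsk.J.map σ
      nsub := fun a ↦ σ (Dsk.nsub a)
      nsub_regular := hreg
      J_eq_span := by
        rw [Dsk.J_eq_span, Ideal.map_span, ← Set.range_comp]
        rfl
      aZeta := fun a ↦ e₁ (Dsk.aZeta a)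
      aZeta_indep := fun a b ↦ by
        change σ (Dsk.nsub b) • e₁ (Dsk.aZeta a) = σ (Dsk.nsub a) • e₁ (Dsk.aZeta b)
        rw [← he₁, ← he₁, Dsk.aZeta_indep] }
  exact ⟨σ, Dsk', e₀, e₁, e₂, he₁, fun a ↦ rfl, he₂, he₀, fun a ↦ rfl, rfl, hσX, hσCX, hσC⟩

/-- ★★★ **The twisted zeta skeleton, ONE CALL from `θ' = θ` on `Gal(K̄/K̃_∞)` (`hker`) and on `N_S` (`hN`)** — with honda's packaged equivalences
`twistEquivOfKer` (p789880) NAMED in the statement and `‖u_i − 1‖ < 1` discharged by `norm_twistUnit_sub_one_lt` (p790189): there are `σ` and a zeta skeleton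
`Dsk'` on the `θ'`-carriers with `Dsk'.aZeta a = twistEquivOfKer … D₁ D₁' (Dsk.aZeta a)`, `Dsk'.nsub = σ ∘ Dsk.nsub`, and all three `twistEquivOfKer` are
`σ`-semilinear. This is the frame datum of the v15 stub `stub_charRoadFrame_ns` (SPEC `Lines/rtt_w3-v15-SPEC.md`).
[cite: JohnsonLeungKings2011, §4.1–§4.2, §5.1–§5.2] [cite: Rubin2000, Ch. VI §6.1–6.2] -/
theorem exists_twistSkeleton_ofKer (hker : ∀ τ ∈ ZpExtension.pairKer κ₁ κ₂, θ' τ = θ τ) :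
    ∃ (σ : IwasawaAlgebraO₂ S ≃+* IwasawaAlgebraO₂ S) (Dsk' : ZetaSkeleton (IwasawaAlgebraO₂ S) Aidx D₀'.H D₁'.H D₂'.H),
      (∀ (r : IwasawaAlgebraO₂ S) (x : D₁.H),
          twistEquivOfKer S κ₁ κ₂ θ θ' 𝔣 hker hN D₁ D₁' (r • x) = σ r • twistEquivOfKer S κ₁ κ₂ θ θ' 𝔣 hker hN D₁ D₁' x) ∧
      (∀ a : Aidx, twistEquivOfKer S κ₁ κ₂ θ θ' 𝔣 hker hN D₁ D₁' (Dsk.aZeta a) = Dsk'.aZeta a) ∧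
      (∀ (r : IwasawaAlgebraO₂ S) (x : D₂.H),
          twistEquivOfKer S κ₁ κ₂ θ θ' 𝔣 hker hN D₂ D₂' (r • x) = σ r • twistEquivOfKer S κ₁ κ₂ θ θ' 𝔣 hker hN D₂ D₂' x) ∧
      (∀ (r : IwasawaAlgebraO₂ S) (x : D₀.H),
          twistEquivOfKer S κ₁ κ₂ θ θ' 𝔣 hker hN D₀ D₀' (r • x) = σ r • twistEquivOfKer S κ₁ κ₂ θ θ' 𝔣 hker hN D₀ D₀' x) ∧
      (∀ a : Aidx, Dsk'.nsub a = σ (Dsk.nsub a)) ∧ Dsk'.J = Dsk.J.map σ ∧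
      σ X = C (C (((θ γ₁ * (θ' γ₁)⁻¹ : (padicCoeffIntegers S)ˣ)) : padicCoeffIntegers S)) * (1 + X) - 1 ∧
      σ (C X) = C (C (((θ γ₂ * (θ' γ₂)⁻¹ : (padicCoeffIntegers S)ˣ)) : padicCoeffIntegers S)) * (1 + C X) - 1 ∧
      (∀ c : padicCoeffIntegers S, σ (C (C c)) = C (C c)) := by
  obtain ⟨σ, hσX, hσCX', hσC, -, -⟩ := exists_twistRingEquiv S (θ γ₁ * (θ' γ₁)⁻¹) (θ γ₂ * (θ' γ₂)⁻¹)
    (norm_twistUnit_sub_one_lt S κ₁ κ₂ θ θ' hker γ₁) (norm_twistUnit_sub_one_lt S κ₁ κ₂ θ θ' hker γ₂)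
  have hσCX : σ.toRingHom (C X) = C (C (((θ γ₂ * (θ' γ₂)⁻¹ : (padicCoeffIntegers S)ˣ)) : padicCoeffIntegers S)) * (1 + C X) - 1 := by
    rw [RingEquiv.toRingHom_eq_coe, RingHom.coe_coe, hσCX', map_sub, map_one, map_mul, map_add, map_one]
  have he₀ : ∀ (r : IwasawaAlgebraO₂ S) (x : D₀.H),
      twistEquivOfKer S κ₁ κ₂ θ θ' 𝔣 hker hN D₀ D₀' (r • x) = σ r • twistEquivOfKer S κ₁ κ₂ θ θ' 𝔣 hker hN D₀ D₀' x := fun r x ↦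
    twistEquivOfKer_smul S κ₁ κ₂ θ θ' 𝔣 (Nat.zero_le 2) hker hN D₀ D₀' σ.toRingHom hσC hσX hσCX r x
  have he₁ : ∀ (r : IwasawaAlgebraO₂ S) (x : D₁.H),
      twistEquivOfKer S κ₁ κ₂ θ θ' 𝔣 hker hN D₁ D₁' (r • x) = σ r • twistEquivOfKer S κ₁ κ₂ θ θ' 𝔣 hker hN D₁ D₁' x := fun r x ↦
    twistEquivOfKer_smul S κ₁ κ₂ θ θ' 𝔣 (by norm_num) hker hN D₁ D₁' σ.toRingHom hσC hσX hσCX r x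
  have he₂ : ∀ (r : IwasawaAlgebraO₂ S) (x : D₂.H),
      twistEquivOfKer S κ₁ κ₂ θ θ' 𝔣 hker hN D₂ D₂' (r • x) = σ r • twistEquivOfKer S κ₁ κ₂ θ θ' 𝔣 hker hN D₂ D₂' x := fun r x ↦
    twistEquivOfKer_smul S κ₁ κ₂ θ θ' 𝔣 le_rfl hker hN D₂ D₂' σ.toRingHom hσC hσX hσCX r x
  have hreg : ∀ a : Aidx, IsSMulRegular (IwasawaAlgebraO₂ S) (σ (Dsk.nsub a)) := fun a x y hxy ↦ by
    apply σ.symm.injective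
    apply Dsk.nsub_regular a
    change Dsk.nsub a * σ.symm x = Dsk.nsub a * σ.symm y
    apply σ.injective
    rw [map_mul, map_mul, RingEquiv.apply_symm_apply, RingEquiv.apply_symm_apply]
    exact hxy
  let Dsk' : ZetaSkeleton (IwasawaAlgebraO₂ S) Aidx D₀'.H D₁'.H D₂'.H :=
    { J := Dsk.J.map σ
      nsub := fun a ↦ σ (Dsk.nsub a)
      nsub_regular := hreg
      J_eq_span := by
        rw [Dsk.J_eq_span, Ideal.map_span, ← Set.range_comp]
        rfl
      aZeta := fun a ↦ twistEquivOfKer S κ₁ κ₂ θ θ' 𝔣 hker hN D₁ D₁' (Dsk.aZeta a)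
      aZeta_indep := fun a b ↦ by
        change σ (Dsk.nsub b) • twistEquivOfKer S κ₁ κ₂ θ θ' 𝔣 hker hN D₁ D₁' (Dsk.aZeta a) =
          σ (Dsk.nsub a) • twistEquivOfKer S κ₁ κ₂ θ θ' 𝔣 hker hN D₁ D₁' (Dsk.aZeta b)
        rw [← he₁, ← he₁, Dsk.aZeta_indep] }
  exact ⟨σ, Dsk', he₁, fun a ↦ rfl, he₂, he₀, fun a ↦ rfl, rfl, hσX, hσCX, hσC⟩

end Skeleton

end Summit.BirchSwinnertonDyer.BirchSwinnertonDyer.Theorems.SmallImageRttD2Twist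

end
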